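/-
Copyright (c) 2026 the pub-hodgecm-mathlib formalisation cell (harness21).  Prover seat hodgecm-mathlib-LH4-p09 (g4): Track A «(D-RAM) FOUR-FRAME» squad of crux H413,
the (ρ2b′-X) census of `Cruxes/H413/Lines/F0_P3c_DyRamFourFrame_U2H_HSide.lean` :418 — payer LH4-p14 (g3) ORDER v1 organ O-Hside «LEAN LEG», brick 1: THE EVEN SELF-DUAL
LATTICES OF THE HYPERBOLIC PLANE ARE ONE `U(σ, J₂)`-ORBIT (2-free, datum-free); 2026-09-04.
-/
import Literature.NumberTheory.Automorphic.UnitaryLatticeTreeSelfDualTransitiveTwo   -- ★ p848050 (F0P3a-p05 (g17)): rank-2 `J₂` algebra `antidiagonal_two_over_apply`, `det_gram_two`, `det_antidiagonal_two`, `isSelfDualLattice_stdLattice_two_of_v`, `transpose_of_mulVec_single_two`; brings ★ htr₀-ram `exists_zpow_smul_single_mem_primitive`, ★ `isUnimodularLattice_of_isSelfDualLattice` + the `IsUnimodularLattice` API, ★ `B₀_mulVec_single_eq_gram`, ★ `latt_le_iff_forall_mulVec_single_mem`, ★ `mem_mapGL_iff`, ★ `pairing_antidiagonal`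
import HarnessLib

/-!
# The lattice graph of a hermitian space — THE EVEN SELF-DUAL LATTICES OF THE HYPERBOLIC PLANE `(K², antidiag(1,1))` FORM ONE `U(σ, J₂)`-ORBIT, AT EVERY PLACE
# (Jacobowitz 1962 §4, §9 Prop. 9.1; O'Meara §82F, §93; Bruhat–Tits 1972 §10)

Topic `NumberTheory/Automorphic`; namespace `Literature.NumberTheory.Automorphic.UnitaryLatticeTree`.  THEOREMS ONLY (no definition, no instance, no notation, no named fact,
no `sorry`, default heartbeats); kernel lane `--supports stmt-HodgeConjecture-24833` (count-neutral).  Cell `pub/hodgecm-mathlib` (D-0151), crux H413 = `stmt-HodgeConjecture-24833`;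
squad F0∕P3c∕LH4 «(D-RAM) FOUR-FRAME», unit U2H, the WILD type-(2) census (ρ2b′-X) `stub_U2H_fixedPointCensus_typeTwo_unit0` (:418): payer LH4-p14 (g3) ORDER v1
(`F0/P3c/LH4/LH4-p14/g3/RHO2BX-ORDER.v1.LH4p14g3.md`) organ **O-Hside**, the «LEAN LEG» (bus 2026-09-04T04:08:25Z (3)): the H-SIDE count `#Fix_{γ₂}(U₂(L⁺_v) ⧸ K₂)` of :418 is,
by ★ Kottwitz's dictionary `natCard_fixedBy_quotient_eq_ncard_orbit`, the number of `γ₂`-fixed lattices in the ORBIT `U(σ_w, J₂)(E_w)·𝒪_w²` — and THIS file identifies that orbit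
intrinsically, WITHOUT `|2| = 1`: it is the set of EVEN self-dual lattices.

THE MATHEMATICS (`σ` an involution of `K` preserving `v`, `ϖ` a uniformiser, `J₂ = antidiag(1,1)`, `h(x,y) = (σx)ᵀ J₂ y = pairing σ J₂ x y = B₀ σ 2 x y`).  Call a lattice
`M ⊂ K²` EVEN when every `h(y,y)`, `y ∈ M`, is a TRACE `s + σs` of an INTEGER `s` (Jacobowitz's norm ideal condition `nM ⊆ nH(0)`; at a tame or inert place every `σ`-fixed integer
is such a trace and the condition is void, at a WILDLY ramified place `Tr 𝒪_E ⊊ 𝒪_F` and the unimodular plane `[[0,1],[1,a]]`, `a ∉ Tr 𝒪_E`, is self-dual but NOT in the orbit —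
`U(σ, J₂)` is not transitive on all self-dual lattices there, cf. ★ `UnitaryLatticeTreeSelfDualTransitiveWild` (rank 3 is saved by the cross vector)).
(§1) `h(x,x) = s + σs` with `s = σ(x₁)x₀` for EVERY `x ∈ K²`; so `𝒪²` is even, and so is every `u·𝒪²`, `u ∈ U(σ, J₂)` (`h` is `u`-invariant).  (§2) **Conversely every even
self-dual `M` is `u·𝒪²`**: as in ★ `exists_unitary_mapGL_stdLattice_eq_of_isSelfDualLattice_two_of_trace` take a primitive isotropic `f₀ = ϖᵏe₀ ∈ M` and a partner `y ∈ M` with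
`h(f₀,y) = 1` (★ O'Meara 82:17); evenness of `y` ALONE — `h(y,y) = s + σs`, `|s| ≤ 1` — replaces the global trace element: `f₂ := y − s·f₀ ∈ M` is isotropic with `h(f₀,f₂) = 1`,
so `u := (f₀ | f₂)` has Gram matrix EXACTLY `J₂`, `u·𝒪² ≤ M`, both unimodular ⇒ equal.  (§3) Hence **`{u·𝒪² : u ∈ U(σ,J₂)} = {M : M self-dual ∧ M even}`**, also `∧`-ed with
any further predicate (the shape consumed by `Set.ncard` counts of `γ₂`-fixed lattices).  No hypothesis on `σϖ`, on `|2|`, or on the residue field.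

* §1 `B₀_two_self_eq_add_map`, `exists_B₀_two_self_eq_add_map_of_mem_stdLattice`, `exists_pairing_self_eq_add_map_of_mem_mapGL_stdLattice` (orbit ⇒ even).
* §2 **`exists_unitary_mapGL_stdLattice_eq_of_isSelfDualLattice_two_of_even`** (even self-dual ⇒ orbit).
* §3 **`exists_unitary_mapGL_stdLattice_eq_iff_isSelfDualLattice_and_even`**, **`setOf_orbit_stdLattice_two_eq_setOf_isSelfDualLattice_even`** (the orbit, as a set, with a spectator predicate).

HONEST LABEL: HC_CM is proved only modulo the 7 printed citations (2 remaining named inputs: hLiu418 = stmt-HodgeConjecture-24832, h413 = stmt-HodgeConjecture-24833) until rung 0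
closes; elementary lattice algebra over a valuation ring with involution, count-neutral (the O-Hside organ's CM dress `Theorems/F0P3cDyRamHSideLatticeCount` consumes §3).

## References
* [Jacobowitz1962] R. Jacobowitz, *Hermitian forms over local fields*, Amer. J. Math. 84 (1962), §4 (unimodular lattices, partners, Gram matrices), §9 Prop. 9.1 (the plane
  `[[0,πⁱ],[π̄ⁱ,a]]` is `≅ H(i)` exactly when `a ∈ nH(i)` — at `i = 0`: a unimodular plane is hyperbolic iff its norm ideal lies in `nH(0) = Tr 𝒪_E`).
* [Omeara1963] O. T. O'Meara, *Introduction to Quadratic Forms* (1963), §82F (82:17) (primitive vectors of unimodular lattices have partners), §93 (even unimodular lattices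
  and hyperbolic planes at dyadic places — the quadratic-form twin).
* [BruhatTits1972] F. Bruhat, J. Tits, *Groupes réductifs sur un corps local I*, Publ. Math. IHÉS 41 (1972), §10 (vertices of the rank-one building as lattice orbits).
-/

set_option autoImplicit false

noncomputable section

open scoped Valued WithZero Matrix MatrixGroups

namespace Literature.NumberTheory.Automorphic.UnitaryLatticeTree

open Literature.NumberTheory.Automorphic Literature.NumberTheory.Automorphic.HermitianLattice
open Literature.NumberTheory.Automorphic.CartanUnique

variable {K : Type*} [Field K] [Valued K ℤᵐ⁰] {σ : K →+* K} {ϖ : K}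

/-! ## §1 Evenness: `h(x,x)` is a trace for every `x ∈ 𝒪²`, and `U(σ, J₂)` preserves it -/

omit [Valued K ℤᵐ⁰] in
/-- `h(x,x) = s + σs` with `s = σ(x₁)·x₀`, for EVERY `x ∈ K²` and any involution `σ` (`J₂ = antidiag(1,1)` has zero diagonal). [cite: Jacobowitz1962, §4] -/
theorem B₀_two_self_eq_add_map (hσ : ∀ a, σ (σ a) = a) (x : Fin 2 → K) :
    B₀ σ 2 x x = σ (x 1) * x 0 + σ (σ (x 1) * x 0) := by
  have h0 : Fin.rev (0 : Fin 2) = 1 := rfl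
  have h1 : Fin.rev (1 : Fin 2) = 0 := rfl
  rw [B₀_apply, Fin.sum_univ_two, h0, h1, map_mul, hσ]
  ring

/-- Every `x ∈ 𝒪²` is EVEN: `h(x,x) = s + σs` with `|s| ≤ 1` (`σ` preserving `v`). [cite: Jacobowitz1962, §4] -/
theorem exists_B₀_two_self_eq_add_map_of_mem_stdLattice (hσ : ∀ a, σ (σ a) = a) (hvσ : ∀ a, Valued.v (σ a) = Valued.v a)
    {x : Fin 2 → K} (hx : x ∈ stdLattice K 2) : ∃ s : K, Valued.v s ≤ 1 ∧ B₀ σ 2 x x = s + σ s := by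
  refine ⟨σ (x 1) * x 0, ?_, B₀_two_self_eq_add_map hσ x⟩
  rw [map_mul, hvσ]
  exact mul_le_one' (mem_stdLattice.1 hx 1) (mem_stdLattice.1 hx 0)

/-- **THE ORBIT IS EVEN**: for `u ∈ U(σ, J₂)` every `y ∈ u·𝒪²` has `h(y,y) = s + σs` with `|s| ≤ 1` (`h` is `u`-invariant and `𝒪²` is even).  Stated for the tree's pairing token
`pairing σ J₂`. [cite: Jacobowitz1962, §4] [cite: BruhatTits1972, §10] -/
theorem exists_pairing_self_eq_add_map_of_mem_mapGL_stdLattice (hσ : ∀ a, σ (σ a) = a) (hvσ : ∀ a, Valued.v (σ a) = Valued.v a)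
    (u : unitaryGroupOfForm σ ((StdForm.antidiagonal 2).over K)) {y : Fin 2 → K} (hy : y ∈ mapGL (u : GL (Fin 2) K) (stdLattice K 2)) :
    ∃ s : K, Valued.v s ≤ 1 ∧ pairing σ ((StdForm.antidiagonal 2).over K) y y = s + σ s := by
  rw [mem_mapGL_iff] at hy
  obtain ⟨s, hs, hss⟩ := exists_B₀_two_self_eq_add_map_of_mem_stdLattice hσ hvσ hy
  refine ⟨s, hs, ?_⟩
  have hu := (mem_unitaryGroupOfForm_antidiagonal_iff (σ := σ) (u : GL (Fin 2) K)).1 u.2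
    ((((u : GL (Fin 2) K)⁻¹ : GL (Fin 2) K) : Matrix (Fin 2) (Fin 2) K).mulVec y) ((((u : GL (Fin 2) K)⁻¹ : GL (Fin 2) K) : Matrix (Fin 2) (Fin 2) K).mulVec y)
  rw [Matrix.mulVec_mulVec, ← Units.val_mul, mul_inv_cancel, Units.val_one, Matrix.one_mulVec] at hu
  rw [pairing_antidiagonal, hu, hss]

/-! ## §2 Every EVEN self-dual lattice of `(K², J₂)` is `u·𝒪²`, `u ∈ U(σ, J₂)` — no trace element, no `|2| = 1` -/

/-- **`U(σ, J₂)` IS TRANSITIVE ON THE EVEN SELF-DUAL LATTICES OF THE HYPERBOLIC PLANE — AT EVERY PLACE.**  `σ` an involution preserving `v`, `ϖ` a uniformiser; `M` self-dual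
(for `J₂`, any scaling parameter `ϖ′`) and EVEN (`h(y,y) = s_y + σs_y`, `|s_y| ≤ 1`, for every `y ∈ M`).  Then `M = u·𝒪²` with `u ∈ U(σ, J₂)`: primitive isotropic `f₀ = ϖᵏe₀ ∈ M`,
partner `y` (`h(f₀,y) = 1`), isotropic `f₂ = y − s_y·f₀` with `h(f₀,f₂) = 1`; `u = (f₀ | f₂)` has Gram `J₂` and `u·𝒪² ≤ M`, both unimodular ⇒ equal.  (At a wildly ramified place
evenness is NECESSARY: `[[0,1],[1,a]]` with `a ∉ Tr 𝒪` is self-dual and not in the orbit.) [cite: Jacobowitz1962, §9 Prop. 9.1] [cite: Omeara1963, §82F (82:17)] [cite: BruhatTits1972, §10] -/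
theorem exists_unitary_mapGL_stdLattice_eq_of_isSelfDualLattice_two_of_even (hσ : ∀ x, σ (σ x) = x) (hvσ : ∀ a, Valued.v (σ a) = Valued.v a)
    (hϖ : Valued.v ϖ = WithZero.exp (-1 : ℤ))
    {ϖ' : K} {M : Submodule 𝒪[K] (Fin 2 → K)} (hM : IsSelfDualLattice σ ϖ' ((StdForm.antidiagonal 2).over K) M)
    (heven : ∀ y ∈ M, ∃ s : K, Valued.v s ≤ 1 ∧ pairing σ ((StdForm.antidiagonal 2).over K) y y = s + σ s) :
    ∃ u : unitaryGroupOfForm σ ((StdForm.antidiagonal 2).over K), mapGL (u : GL (Fin 2) K) (stdLattice K 2) = M := by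
  have herm : ∀ y z : Fin 2 → K, B₀ σ 2 z y = σ (B₀ σ 2 y z) := fun y z => (isHermitianForm_B₀ hσ y z).symm
  have hL : IsUnimodularLattice (B₀ σ 2) (frame K 2 Finset.univ) M := isUnimodularLattice_of_isSelfDualLattice hvσ hM
  obtain ⟨g, hMg, -, -, -⟩ := id hM
  -- the primitive isotropic `f₀ = ϖᵏ e₀ ∈ M` and its partner `y`
  obtain ⟨k, hf₀M, hprim⟩ := exists_zpow_smul_single_mem_primitive hϖ g 0
  rw [← hMg] at hf₀M hprim
  set f₀ : Fin 2 → K := (ϖ ^ k) • (Pi.single 0 1 : Fin 2 → K) with hf₀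
  have hf₀f₀ : B₀ σ 2 f₀ f₀ = 0 := by
    rw [hf₀, form_smul_left, form_smul_right, B₀_single_single, if_neg (by decide), mul_zero, mul_zero]
  obtain ⟨y, hyM, hf₀y⟩ := hL.exists_apply_eq_one_of_not_mem' hϖ hvσ (isHermitianForm_B₀ hσ) hf₀M hprim
  have hyf₀ : B₀ σ 2 y f₀ = 1 := by rw [herm, hf₀y, map_one]
  -- evenness of the partner: `h(y,y) = s + σ s`, `|s| ≤ 1`
  obtain ⟨s, hs1, hss⟩ := heven y hyM
  rw [pairing_antidiagonal] at hss
  -- the isotropic partner `f₂ = y + ν f₀`, `ν = −s`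
  set ν : K := -s with hν
  have hvν : Valued.v ν ≤ 1 := by rw [hν, Valuation.map_neg]; exact hs1
  set f₂ : Fin 2 → K := y + ν • f₀ with hf₂
  have hf₂M : f₂ ∈ M := M.add_mem hyM (smul_mem_of_v_le _ hvν hf₀M)
  have hf₀f₂ : B₀ σ 2 f₀ f₂ = 1 := by rw [hf₂, map_add, form_smul_right, hf₀y, hf₀f₀, mul_zero, add_zero]
  have hf₂f₀ : B₀ σ 2 f₂ f₀ = 1 := by rw [herm, hf₀f₂, map_one]
  have hf₂f₂ : B₀ σ 2 f₂ f₂ = 0 := by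
    have h : B₀ σ 2 f₂ f₂ = B₀ σ 2 y y + ν + σ ν := by
      simp only [hf₂, map_add, LinearMap.add_apply, form_smul_left, form_smul_right, hyf₀, hf₀y, hf₀f₀]; ring
    rw [h, hss, hν, map_neg]; ring
  -- the unitary matrix `u = (f₀ | f₂)`
  set U : Matrix (Fin 2) (Fin 2) K := (Matrix.of ![f₀, f₂])ᵀ with hU
  have hU0 : U.mulVec (Pi.single 0 1) = f₀ := transpose_of_mulVec_single_two _ 0
  have hU1 : U.mulVec (Pi.single 1 1) = f₂ := transpose_of_mulVec_single_two _ 1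
  have hUJ : (U.map σ)ᵀ * (StdForm.antidiagonal 2).over K * U = (StdForm.antidiagonal 2).over K := by
    ext i j
    rw [← B₀_mulVec_single_eq_gram, antidiagonal_two_over_apply]
    fin_cases i <;> fin_cases j <;>
      simp only [Fin.zero_eta, Fin.mk_one, hU0, hU1, hf₀f₀, hf₀f₂, hf₂f₀, hf₂f₂] <;> rfl
  have hdetU : U.det ≠ 0 := by
    intro h
    have h2 := congrArg Matrix.det hUJ
    rw [det_gram_two, h, mul_zero, neg_zero, det_antidiagonal_two] at h2
    norm_num at h2
  set u : GL (Fin 2) K := Matrix.GeneralLinearGroup.mkOfDetNeZero U hdetU with hu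
  have huval : (u : Matrix (Fin 2) (Fin 2) K) = U := rfl
  have huU : u ∈ unitaryGroupOfForm σ ((StdForm.antidiagonal 2).over K) := by rw [mem_unitaryGroupOfForm_iff, huval]; exact hUJ
  refine ⟨⟨u, huU⟩, ?_⟩
  change mapGL u (stdLattice K 2) = M
  have hlatt : mapGL u (stdLattice K 2) = latt U := by rw [← latt_one, mapGL_latt_eq, huval, Matrix.mul_one]
  -- `u·𝒪² ≤ M`
  have hle : mapGL u (stdLattice K 2) ≤ M := by
    rw [hlatt, latt_le_iff_forall_mulVec_single_mem]
    intro j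
    fin_cases j
    · simp only [Fin.zero_eta]; rw [hU0]; exact hf₀M
    · simp only [Fin.mk_one]; rw [hU1]; exact hf₂M
  -- both unimodular ⇒ equal
  have h0 : IsSelfDualLattice σ ϖ ((StdForm.antidiagonal 2).over K) (mapGL u (stdLattice K 2)) :=
    isVertexLattice_mapGL σ ϖ _ u huU (isSelfDualLattice_stdLattice_two_of_v hϖ)
  exact IsUnimodularLattice.eq_of_le hL (isUnimodularLattice_of_isSelfDualLattice hvσ h0) hle

/-! ## §3 The orbit `U(σ, J₂)·𝒪²` = the even self-dual lattices -/

/-- **THE ORBIT OF THE ROOT `𝒪²` UNDER `U(σ, J₂)` IS EXACTLY THE SET OF EVEN SELF-DUAL LATTICES** of the hyperbolic plane (for the tree parameters `(σ, ϖ, J₂)`, `ϖ` a uniformiser,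
`σ` an involution preserving `v`): `(∃ u ∈ U(σ,J₂), u·𝒪² = M) ⟺ M self-dual ∧ ∀ y ∈ M, h(y,y) ∈ {s + σs : |s| ≤ 1}`.  (⇒) ★ `isVertexLattice_mapGL` + ★ `isSelfDualLattice_stdLattice_two_of_v`
+ §1; (⇐) §2. [cite: Jacobowitz1962, §9 Prop. 9.1] [cite: BruhatTits1972, §10] -/
theorem exists_unitary_mapGL_stdLattice_eq_iff_isSelfDualLattice_and_even (hσ : ∀ x, σ (σ x) = x) (hvσ : ∀ a, Valued.v (σ a) = Valued.v a)
    (hϖ : Valued.v ϖ = WithZero.exp (-1 : ℤ)) (M : Submodule 𝒪[K] (Fin 2 → K)) :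
    (∃ u : unitaryGroupOfForm σ ((StdForm.antidiagonal 2).over K), mapGL (u : GL (Fin 2) K) (stdLattice K 2) = M) ↔
      IsSelfDualLattice σ ϖ ((StdForm.antidiagonal 2).over K) M ∧
        ∀ y ∈ M, ∃ s : K, Valued.v s ≤ 1 ∧ pairing σ ((StdForm.antidiagonal 2).over K) y y = s + σ s := by
  constructor
  · rintro ⟨u, rfl⟩
    exact ⟨isVertexLattice_mapGL σ ϖ _ (u : GL (Fin 2) K) u.2 (isSelfDualLattice_stdLattice_two_of_v hϖ),
      fun y hy => exists_pairing_self_eq_add_map_of_mem_mapGL_stdLattice hσ hvσ u hy⟩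
  · rintro ⟨hM, heven⟩
    exact exists_unitary_mapGL_stdLattice_eq_of_isSelfDualLattice_two_of_even hσ hvσ hϖ hM heven

/-- **THE ORBIT AS A SET, WITH A SPECTATOR PREDICATE** (the shape of ★ Kottwitz's dictionary `natCard_fixedBy_quotient_eq_ncard_orbit`, `P M := (γ·M = M)`): for any monoid map
`ι : G →* GL₂(K)` ONTO `U(σ, J₂)` (`∀ g, ι g ∈ U(σ,J₂)` and `∀ u ∈ U(σ,J₂), ∃ g, ι g = u` — e.g. the one-place model `localNonsplitEquiv` of a CM unitary group),
`{M | (∃ g, ι(g)·𝒪² = M) ∧ P M} = {M | M self-dual ∧ M even ∧ P M}`. [cite: Jacobowitz1962, §9 Prop. 9.1] [cite: BruhatTits1972, §10] -/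
theorem setOf_orbit_stdLattice_two_eq_setOf_isSelfDualLattice_even (hσ : ∀ x, σ (σ x) = x) (hvσ : ∀ a, Valued.v (σ a) = Valued.v a)
    (hϖ : Valued.v ϖ = WithZero.exp (-1 : ℤ)) {G : Type*} [Group G] (ι : G →* GL (Fin 2) K)
    (hι : ∀ g : G, ι g ∈ unitaryGroupOfForm σ ((StdForm.antidiagonal 2).over K))
    (hιonto : ∀ u : GL (Fin 2) K, u ∈ unitaryGroupOfForm σ ((StdForm.antidiagonal 2).over K) → ∃ g : G, ι g = u)
    (P : Submodule 𝒪[K] (Fin 2 → K) → Prop) :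
    {M : Submodule 𝒪[K] (Fin 2 → K) | (∃ g : G, mapGL (ι g) (stdLattice K 2) = M) ∧ P M} =
      {M : Submodule 𝒪[K] (Fin 2 → K) | IsSelfDualLattice σ ϖ ((StdForm.antidiagonal 2).over K) M ∧
        (∀ y ∈ M, ∃ s : K, Valued.v s ≤ 1 ∧ pairing σ ((StdForm.antidiagonal 2).over K) y y = s + σ s) ∧ P M} := by
  ext M
  simp only [Set.mem_setOf_eq]
  have horb : (∃ g : G, mapGL (ι g) (stdLattice K 2) = M) ↔
      ∃ u : unitaryGroupOfForm σ ((StdForm.antidiagonal 2).over K), mapGL (u : GL (Fin 2) K) (stdLattice K 2) = M := by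
    constructor
    · rintro ⟨g, hg⟩; exact ⟨⟨ι g, hι g⟩, hg⟩
    · rintro ⟨u, hu⟩
      obtain ⟨g, hg⟩ := hιonto (u : GL (Fin 2) K) u.2
      exact ⟨g, by rw [hg]; exact hu⟩
  rw [horb, exists_unitary_mapGL_stdLattice_eq_iff_isSelfDualLattice_and_even hσ hvσ hϖ M, and_assoc]

end Literature.NumberTheory.Automorphic.UnitaryLatticeTree

end
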